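import Summits.CriticalPhenomena.PercolationContinuityZ3.Theorems.SoloBlindUnscreening
import Literature.Probability.Percolation.CriticalContinuityProofs
import Literature.Probability.Percolation.HalfSpaceBGN
import HarnessLib

/-!
# The wall is at most polynomially repulsive AT `p_c`: `P_{p_c}(0 ↔ v inside ℍ) ≥ p_c / (2d (2m+1)^{2d})`

Seat `solo-CriticalPhenomena-blind` (generation 3), sequel to `SoloBlindUnscreening`.  There the
wall-to-depth connection bound was proved for `p_c < p < 1` from the DKT face point, which rests
on `φ_p(Λ_{m-1}) ≥ 1` (`DKT20.one_le_phi`, stated for `p > p_c`).  Here we push it to the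
critical point itself:

* `one_le_phi_criticalProbI` — **`φ_{p_c}(S) ≥ 1` for every finite `S ∋ 0`** (`d ≥ 2`): the limit
  `p ↓ p_c` of `DKT20.one_le_phi` (`p ↦ φ_p(S)` is continuous, a finite sum of probabilities of
  local events);
* `exists_face_point_of_one_le_phi` — the DKT face-point argument run from the hypothesis
  `φ_p(Λ_{m-1}) ≥ 1` (any `p`), and `exists_face_point_criticalProbI` — its instance at `p_c`;
* `exists_deep_point_halfSpace_criticalProbI` — **at `p = p_c(ℤ^d)`, `d ≥ 2`, for every `m ≥ 1`
  there is `v ∈ Λ_{2m}` with `v₀ ≥ m` and `P_{p_c}(0 ↔ v inside ℍ) ≥ p_c / (2d (2m+1)^{2d})`**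
  (lowest-point lemma, translation, union bound, exactly as in `SoloBlindUnscreening`); the `d = 3`
  form `exists_deep_point_halfSpace_criticalProb_Z3` has the constant `p_c(ℤ³) / (6 (2m+1)^6)`.

In words: at criticality an open path from a wall vertex reaches depth `m` inside the half-space
with probability at least `c m^{-2d}`; the wall-to-bulk connectivity exponent of critical `ℤ^d`
percolation is at most `2d`.  (The half-space boundary estimates this sub-problem needs are UPPER
bounds of this type with exponent `> 1` along the wall; this file records what is provable from
below with the same elementary tools.)
-/

noncomputable section

namespace Summit.CriticalPhenomena.PercolationContinuityZ3.Theorems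

open MeasureTheory Filter Topology Literature.Probability.Percolation Literature.Probability.LatticeModels
open scoped Classical

variable {d : ℕ}

/-! ### `φ_p(S)` is continuous in `p`, hence `φ_{p_c}(S) ≥ 1` -/

/-- **`φ_{p_c}(S) ≥ 1` for every finite `S ∋ 0`** (`d ≥ 2`): the inequality `φ_p(S) ≥ 1` for
`p_c < p < 1` passes to the limit `p ↓ p_c` by continuity (`p_c < 1`). -/
theorem one_le_phi_criticalProbI (hd : 2 ≤ d) {S : Finset (Site d)} (h0 : (0 : Site d) ∈ S) :
    1 ≤ DCT16.phi (criticalProbI d) S := by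
  set pc : ℝ := criticalProb (zdGraph d) (0 : Site d) with hpc
  have hpc1 : pc < 1 := criticalProb_zd_lt_one hd
  have hpcI : pc ∈ Set.Icc (0 : ℝ) 1 := criticalProb_mem_Icc _ _
  -- `p ↦ φ_p(S)` is continuous on `[0,1]` (finite sum of probabilities of events determined by
  -- the finitely many pairs of vertices of `S`; the tree has this in several places)
  have hcont : Continuous fun p : unitInterval => DCT16.phi p S := by
    simp only [DCT16.phi_def]
    refine continuous_subtype_val.mul
      (continuous_finsetSum _ fun x _ => continuous_finsetSum _ fun y _ => ?_)
    exact continuous_bondPercolation_real_of_determinedBy (zdGraph d)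
      (DCT16.determinedBy_openConnIn (↑S) (0 : Site d) x (K := ↑S.sym2) (by rw [Finset.coe_sym2]))
  -- the real-variable extension `F q = φ_{proj q}(S)`
  set F : ℝ → ℝ := fun q => DCT16.phi (Set.projIcc (0 : ℝ) 1 zero_le_one q) S with hF
  have hFc : Continuous F := hcont.comp continuous_projIcc
  have hFpc : F pc = DCT16.phi (criticalProbI d) S := by
    simp only [hF, Set.projIcc_of_mem _ hpcI]
    rfl
  -- `F q ≥ 1` for `q ∈ (p_c, 1)`
  have hev : ∀ᶠ q in 𝓝[>] pc, (1 : ℝ) ≤ F q := by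
    have hmem : Set.Ioo pc 1 ∈ 𝓝[>] pc := Ioo_mem_nhdsGT hpc1
    filter_upwards [hmem] with q hq
    have hqI : q ∈ Set.Icc (0 : ℝ) 1 := ⟨hpcI.1.trans hq.1.le, hq.2.le⟩
    have hproj : Set.projIcc (0 : ℝ) 1 zero_le_one q = ⟨q, hqI⟩ := Set.projIcc_of_mem _ hqI
    simp only [hF, hproj]
    exact DKT20.one_le_phi ⟨q, hqI⟩ (by simpa [hpc] using hq.1) (by simpa using hq.2) h0
  have htend : Tendsto F (𝓝[>] pc) (𝓝 (F pc)) :=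
    (hFc.continuousAt.tendsto).mono_left nhdsWithin_le_nhds
  rw [← hFpc]
  exact ge_of_tendsto htend hev

/-! ### The DKT face point from `φ_p(Λ_{m-1}) ≥ 1` -/

/-- **A good boundary point from `φ_p(Λ_{m-1}) ≥ 1`** (the argument of `DKT20.exists_face_point`,
with its use of `p > p_c` replaced by the hypothesis; `p < 1`): there is `y ∈ Λ_m` with a coordinate of
modulus `m` and `P_p(0 ↔ y inside Λ_m) ≥ p / (2d (2m+1)^d)`. -/
theorem exists_face_point_of_one_le_phi (hd : 1 ≤ d) (p : unitInterval) (hp1 : (p : ℝ) < 1)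
    {m : ℕ} (hm : 1 ≤ m) (hφ : 1 ≤ DCT16.phi p (box d (m - 1))) :
    ∃ y ∈ box d m, (∃ i : Fin d, |y i| = m) ∧
      (p : ℝ) / (2 * d * (2 * m + 1) ^ d) ≤
        (bondPercolation (zdGraph d) p).real (openConnIn (↑(box d m)) 0 y) := by
  set S : Finset (Site d) := box d (m - 1) with hS
  set μ := bondPercolation (zdGraph d) p with hμ
  have hd0 : (0 : ℝ) < d := by exact_mod_cast hd
  -- the number of terms
  have hcardS : (S.card : ℝ) ≤ (2 * m + 1) ^ d := by
    have h1 : S.card = (2 * (m - 1) + 1) ^ d := by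
      have : S = GM.ball (0 : Site d) (m - 1) := by
        ext z; simp [hS, mem_box]
      rw [this, GM.card_ball]
    rw [h1]; push_cast
    exact pow_le_pow_left₀ (by positivity) (by
      have : ((m - 1 : ℕ) : ℝ) ≤ m := by exact_mod_cast Nat.sub_le m 1
      linarith) d
  set t : ℝ := 1 / (2 * d * (2 * m + 1) ^ d) with ht
  have ht0 : 0 < t := by positivity
  -- pigeonhole in `φ_p(S) ≥ 1`
  rw [DCT16.phi_def] at hφ
  have hex : ∃ x ∈ S, ∃ y ∈ ((zdGraph d).neighborFinset x).filter (fun y => y ∉ S),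
      t ≤ μ.real (openConnIn (↑S) 0 x) := by
    by_contra hno
    push Not at hno
    have hsum : ∑ x ∈ S, ∑ y ∈ ((zdGraph d).neighborFinset x).filter (fun y => y ∉ S),
        μ.real (openConnIn (↑S) 0 x) ≤ 1 := by
      calc ∑ x ∈ S, ∑ y ∈ ((zdGraph d).neighborFinset x).filter (fun y => y ∉ S), μ.real (openConnIn (↑S) 0 x)
          ≤ ∑ x ∈ S, ∑ y ∈ ((zdGraph d).neighborFinset x).filter (fun y => y ∉ S), t :=
            Finset.sum_le_sum fun x hx => Finset.sum_le_sum fun y hy => (hno x hx y hy).le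
        _ ≤ ∑ x ∈ S, (2 * d) * t := by
            refine Finset.sum_le_sum fun x _ => ?_
            rw [Finset.sum_const, nsmul_eq_mul]
            refine mul_le_mul_of_nonneg_right ?_ ht0.le
            have h1 : (((zdGraph d).neighborFinset x).filter (fun y => y ∉ S)).card ≤
                ((zdGraph d).neighborFinset x).card := Finset.card_filter_le _ _
            rw [card_neighborFinset_zdGraph_holds] at h1
            exact_mod_cast h1
        _ = S.card * ((2 * d) * t) := by rw [Finset.sum_const, nsmul_eq_mul]
        _ ≤ (2 * m + 1) ^ d * ((2 * d) * t) := mul_le_mul_of_nonneg_right hcardS (by positivity)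
        _ = 1 := by rw [ht]; field_simp
    have : (p : ℝ) * ∑ x ∈ S, ∑ y ∈ ((zdGraph d).neighborFinset x).filter (fun y => y ∉ S),
        μ.real (openConnIn (↑S) 0 x) < 1 := by
      calc (p : ℝ) * _ ≤ p * 1 := mul_le_mul_of_nonneg_left hsum p.2.1
        _ < 1 := by linarith
    linarith
  obtain ⟨x, hx, y, hy, hxt⟩ := hex
  rw [Finset.mem_filter, SimpleGraph.mem_neighborFinset] at hy
  obtain ⟨hadj, hyS⟩ := hy
  -- `y ∈ Λ_m ∖ Λ_{m-1}`
  have hm1 : m - 1 + 1 = m := Nat.sub_add_cancel hm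
  have hyB : y ∈ box d m := by rw [← hm1]; exact DCT16.mem_box_succ_of_adj hx hadj
  have hyi : ∃ i : Fin d, |y i| = m := by
    rw [hS, mem_box] at hyS
    push Not at hyS
    obtain ⟨i, hi⟩ := hyS
    refine ⟨i, ?_⟩
    have hyi := (mem_box.1 hyB) i
    have hm1' : ((m - 1 : ℕ) : ℤ) = m - 1 := by omega
    rw [hm1'] at hi
    rw [abs_eq (by positivity)]
    by_cases hle : -((m : ℤ) - 1) ≤ y i
    · have := hi hle; omega
    · omega
  refine ⟨y, hyB, hyi, ?_⟩
  -- open the boundary edge `{x, y}` independently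
  have hxB : x ∈ box d m := box_mono d (Nat.sub_le m 1) hx
  have hsub : (openConnIn (↑S) 0 x ∩ {ω | s(x, y) ∈ ω} : Set (BondConfig (Site d))) ⊆
      openConnIn (↑(box d m)) 0 y := by
    rintro ω ⟨h1, h2⟩
    refine GM.openConnIn_trans (openConnIn_mono (by rw [hS]; exact_mod_cast box_mono d (Nat.sub_le m 1)) 0 x h1)
      (GM.openConnIn_of_adj (Finset.mem_coe.2 hxB) (Finset.mem_coe.2 hyB) ((openGraph_adj ω x y).2 ⟨h2, hadj.ne⟩))
  have hdet : DeterminedBy (openConnIn (↑S) (0 : Site d) x) ↑(S.sym2) :=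
    DCT16.determinedBy_openConnIn _ 0 x (by rw [Finset.coe_sym2])
  have hdisj : Disjoint S.sym2 {s(x, y)} := by
    rw [Finset.disjoint_singleton_right, Finset.mk_mem_sym2_iff]
    exact fun h => hyS h.2
  have hind := DCT16.real_inter_of_determinedBy_disjoint (zdGraph d) p hdet
    ((determinedBy_mem (s(x, y))).mono (by simp)) hdisj
  have hedge : μ.real {ω | s(x, y) ∈ ω} = p :=
    bondPercolation_cylinder (zdGraph d) p ((SimpleGraph.mem_edgeSet _).2 hadj)
  calc (p : ℝ) / (2 * d * (2 * m + 1) ^ d) = t * p := by rw [ht]; ring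
    _ ≤ μ.real (openConnIn (↑S) 0 x) * μ.real {ω | s(x, y) ∈ ω} := by
        rw [hedge]; exact mul_le_mul_of_nonneg_right hxt p.2.1
    _ = μ.real (openConnIn (↑S) 0 x ∩ {ω | s(x, y) ∈ ω}) := hind.symm
    _ ≤ μ.real (openConnIn (↑(box d m)) 0 y) := measureReal_mono hsub

/-- The face point at the critical point: for `d ≥ 2` and `m ≥ 1` there is `y ∈ Λ_m` with a
coordinate of modulus `m` and `P_{p_c}(0 ↔ y inside Λ_m) ≥ p_c / (2d (2m+1)^d)`. -/
theorem exists_face_point_criticalProbI (hd : 2 ≤ d) {m : ℕ} (hm : 1 ≤ m) :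
    ∃ y ∈ box d m, (∃ i : Fin d, |y i| = m) ∧
      ((criticalProbI d : unitInterval) : ℝ) / (2 * d * (2 * m + 1) ^ d) ≤
        (bondPercolation (zdGraph d) (criticalProbI d)).real (openConnIn (↑(box d m)) 0 y) :=
  exists_face_point_of_one_le_phi (le_trans (by norm_num) hd) (criticalProbI d)
    (by simpa using criticalProb_zd_lt_one hd) hm
    (one_le_phi_criticalProbI hd (zero_mem_box d (m - 1)))

/-! ### From a face point to a deep point inside `ℍ` (any `p`) -/

section Deep

variable [NeZero d]

/-- A face point can be moved to the top face `{y₀ = m}` (signed permutation of coordinates). -/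
theorem exists_top_face_point_of_face (p : unitInterval) {m : ℕ} {t : ℝ}
    (h : ∃ y ∈ box d m, (∃ i : Fin d, |y i| = m) ∧
      t ≤ (bondPercolation (zdGraph d) p).real (openConnIn (↑(box d m)) 0 y)) :
    ∃ y ∈ box d m, y 0 = m ∧ t ≤ (bondPercolation (zdGraph d) p).real (AKN.bconn (box d m) 0 y) := by
  obtain ⟨y, hy, ⟨i, hi⟩, hbound⟩ := h
  have hconv : (bondPercolation (zdGraph d) p).real (openConnIn (↑(box d m)) 0 y) =
      (bondPercolation (zdGraph d) p).real (AKN.bconn (box d m) 0 y) :=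
    measureReal_congr (openConnIn_ae_eq_openConnVia (zdGraph d) p (Finset.mem_coe.2 (zero_mem_box d m)) y)
  set s : ℤˣ := if 0 ≤ y i then 1 else -1 with hs
  set ε : Fin d → ℤˣ := fun j => if j = 0 then s else 1 with hε
  set π : Equiv.Perm (Fin d) := Equiv.swap 0 i with hπ
  refine ⟨Site.signedPerm π ε y, (signedPerm_mem_box_iff π ε).2 hy, ?_, ?_⟩
  · have h1 : Site.signedPerm π ε y 0 = (s : ℤ) * y i := by
      rw [Site.signedPerm_apply, hπ, Equiv.symm_swap, Equiv.swap_apply_left, hε]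
      simp
    rw [h1, hs]
    by_cases hyi : 0 ≤ y i
    · rw [if_pos hyi, Units.val_one, one_mul, ← hi, abs_of_nonneg hyi]
    · rw [if_neg hyi, Units.val_neg, Units.val_one, neg_one_mul, ← hi, abs_of_neg (not_le.1 hyi)]
  · rw [AKN.real_bconn_signedPerm, ← hconv]
    exact hbound

/-- **From a top-face point to a deep point inside `ℍ`** (lowest-point lemma, translation, union
bound over the `(2m+1)^d` possible lowest points): if `y ∈ Λ_m`, `y₀ = m` and
`P_p(0 ↔ y inside Λ_m) ≥ t ≥ 0`, then some `v ∈ Λ_{2m}` with `v₀ ≥ m` has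
`P_p(0 ↔ v inside ℍ) ≥ t / (2m+1)^d`. -/
theorem exists_deep_point_of_top_face (p : unitInterval) {m : ℕ} {t : ℝ} (ht0 : 0 ≤ t) {y : Site d}
    (hy : y ∈ box d m) (hy0 : y 0 = m)
    (hbound : t ≤ (bondPercolation (zdGraph d) p).real (AKN.bconn (box d m) 0 y)) :
    ∃ v ∈ box d (2 * m), (m : ℤ) ≤ v 0 ∧
      t / (2 * m + 1) ^ d ≤
        (bondPercolation (zdGraph d) p).real (openConnVia (withinGraph (zdGraph d) (halfSpace d)) 0 v) := by
  set μ := bondPercolation (zdGraph d) p with hμ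
  set B := (box d m).filter (fun w : Site d => w 0 ≤ 0) with hB
  have hcover : AKN.bconn (box d m) 0 y ⊆
      ⋃ w ∈ B, openConnVia (withinGraph (zdGraph d) {z : Site d | w 0 ≤ z 0}) w y := by
    intro ω hω
    obtain ⟨w, hwbox, hw0, hw⟩ := exists_lowest_point hω
    exact Set.mem_biUnion (Finset.mem_filter.2 ⟨hwbox, hw0⟩) hw
  have hsum : t ≤ ∑ w ∈ B, μ.real (openConnVia (withinGraph (zdGraph d) (halfSpace d)) 0 (y - w)) := by
    calc t ≤ μ.real (AKN.bconn (box d m) 0 y) := hbound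
      _ ≤ μ.real (⋃ w ∈ B, openConnVia (withinGraph (zdGraph d) {z : Site d | w 0 ≤ z 0}) w y) :=
          measureReal_mono hcover (measure_ne_top _ _)
      _ ≤ ∑ w ∈ B, μ.real (openConnVia (withinGraph (zdGraph d) {z : Site d | w 0 ≤ z 0}) w y) :=
          measureReal_biUnion_finset_le _ _
      _ = ∑ w ∈ B, μ.real (openConnVia (withinGraph (zdGraph d) (halfSpace d)) 0 (y - w)) :=
          Finset.sum_congr rfl fun w _ => real_openConnVia_aboveLevel_eq p w y
  have hBne : B.Nonempty := ⟨0, Finset.mem_filter.2 ⟨zero_mem_box d m, le_rfl⟩⟩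
  have hcardB : (B.card : ℝ) ≤ (2 * m + 1) ^ d := by
    have h1 : B.card ≤ (box d m).card := Finset.card_filter_le _ _
    have h2 : (box d m).card = (2 * m + 1) ^ d := by
      have : box d m = GM.ball (0 : Site d) m := by ext z; simp [mem_box]
      rw [this, GM.card_ball]
    rw [h2] at h1
    exact_mod_cast h1
  have hcardpos : (0 : ℝ) < B.card := by exact_mod_cast hBne.card_pos
  obtain ⟨w, hwB, hw⟩ : ∃ w ∈ B, t / B.card ≤
      μ.real (openConnVia (withinGraph (zdGraph d) (halfSpace d)) 0 (y - w)) := by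
    by_contra hno
    push Not at hno
    have : ∑ w ∈ B, μ.real (openConnVia (withinGraph (zdGraph d) (halfSpace d)) 0 (y - w)) <
        ∑ w ∈ B, t / B.card := Finset.sum_lt_sum_of_nonempty hBne fun w hw => hno w hw
    rw [Finset.sum_const, nsmul_eq_mul, mul_div_cancel₀ _ hcardpos.ne'] at this
    linarith
  have hwbox : w ∈ box d m := (Finset.mem_filter.1 hwB).1
  have hw0 : w 0 ≤ 0 := (Finset.mem_filter.1 hwB).2
  refine ⟨y - w, ?_, ?_, ?_⟩
  · rw [mem_box]
    intro j
    have hyj := (mem_box.1 hy) j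
    have hwj := (mem_box.1 hwbox) j
    simp only [Pi.sub_apply]
    push_cast
    constructor <;> omega
  · simp only [Pi.sub_apply]; omega
  · calc t / (2 * m + 1) ^ d ≤ t / B.card := div_le_div_of_nonneg_left ht0 hcardpos hcardB
      _ ≤ _ := hw

end Deep

/-! ### The critical wall-to-depth bound -/

/-- **At `p_c(ℤ^d)` (`d ≥ 2`) an open path from the wall vertex `0` reaches depth `m` inside `ℍ`
with at least polynomial probability**: for every `m ≥ 1` there is `v ∈ Λ_{2m}` with `v₀ ≥ m` and
`P_{p_c}(0 ↔ v inside ℍ) ≥ p_c / (2d (2m+1)^{2d})`. -/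
theorem exists_deep_point_halfSpace_criticalProbI [NeZero d] (hd : 2 ≤ d) {m : ℕ} (hm : 1 ≤ m) :
    ∃ v ∈ box d (2 * m), (m : ℤ) ≤ v 0 ∧
      ((criticalProbI d : unitInterval) : ℝ) / (2 * d * (2 * m + 1) ^ d) / (2 * m + 1) ^ d ≤
        (bondPercolation (zdGraph d) (criticalProbI d)).real
          (openConnVia (withinGraph (zdGraph d) (halfSpace d)) 0 v) := by
  obtain ⟨y, hy, hy0, hbound⟩ :=
    exists_top_face_point_of_face (criticalProbI d) (exists_face_point_criticalProbI hd hm)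
  exact exists_deep_point_of_top_face (criticalProbI d)
    (div_nonneg (criticalProbI d).2.1 (by positivity)) hy hy0 hbound

/-- The same lower bound gives a polynomial lower bound for the wall-to-depth two-point function
combined with the density: `P_{p_c}(0 ↔ v inside ℍ) ≥ p_c (2m+1)^{-2d} / (2d)` with
`m ≤ v₀ ≤ 2m`; here is the `d = 3` instance for the half-space `{x ∈ ℤ³ | 0 ≤ x₀}` of this
sub-problem, with the constant `p_c(ℤ³) / (6 (2m+1)^6)`. -/
theorem exists_deep_point_halfSpace_criticalProb_Z3 {m : ℕ} (hm : 1 ≤ m) :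
    ∃ v ∈ box 3 (2 * m), (m : ℤ) ≤ v 0 ∧
      criticalProb (zdGraph 3) (0 : Site 3) / (6 * (2 * m + 1) ^ 6) ≤
        (bondPercolation (zdGraph 3) (criticalProbI 3)).real
          (openConnVia (withinGraph (zdGraph 3) {x : Site 3 | 0 ≤ x 0}) 0 v) := by
  obtain ⟨v, hv, hv0, h⟩ := exists_deep_point_halfSpace_criticalProbI (d := 3) (by norm_num) hm
  refine ⟨v, hv, hv0, ?_⟩
  have hconst : ((criticalProbI 3 : unitInterval) : ℝ) / (2 * (3 : ℕ) * (2 * m + 1) ^ 3) / (2 * m + 1) ^ 3 =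
      criticalProb (zdGraph 3) (0 : Site 3) / (6 * (2 * m + 1) ^ 6) := by
    rw [coe_criticalProbI]
    push_cast
    field_simp
    ring
  rw [hconst] at h
  exact h

end Summit.CriticalPhenomena.PercolationContinuityZ3.Theorems
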